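import Literature.LinearAlgebra.Matrix.CirculantDFT
import Literature.LinearAlgebra.Matrix.MoorePenroseInverse

/-!
# Moore–Penrose inverses of circulant matrices via the discrete Fourier transform, and the
# periodic second-difference matrix `A⁺ = F_N^* diag(0, −1/(4 sin²(πk/N))) F_N`
# (Plonka–Hoffmann–Weickert 2016, proof of Corollary 2.4; Morillas 2023, §4)

Sources.
* G. Plonka, S. Hoffmann, J. Weickert, *Pseudo-inverses of difference matrices and their
  application to sparse signal approximation*, Linear Algebra Appl. 503 (2016) 26–47,
  arXiv:1504.04266 [PlonkaHoffmannWeickert2016] (held text `paper:arxiv-1504.04266`, §2, proof of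
  Corollary 2.4, p. 5 of the arXiv text).
* P. Morillas, *Expressions and characterizations for the Moore–Penrose inverse of operators and
  matrices*, Electron. J. Linear Algebra 39 (2023) 214–241, arXiv:2112.10856 [Morillas2023]
  (held text `paper:arxiv-2112.10856`, §4 "Moore–Penrose inverse of circulant matrices", the
  display before Theorem 13).
* G. H. Golub, C. F. Van Loan, *Matrix Computations*, 4th ed. (2013), §4.8.2 Theorem 4.8.2
  [GolubVanLoan2013] (the DFT diagonalisation of a circulant; in the tree as
  `Literature.LinearAlgebra.Matrix.circulant_eq_fourier_conj`).
Builds on `Matrix.CirculantDFT` (`circulantEig`, `circulant_eq_fourier_conj`,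
`circulantEig_cycleLapVec`, `cycleLapVec`), `Combinatorics.SimpleGraph.CycleSpectrum`
(`fourierMatrix`, `cycleRoot`, `conjTranspose_fourierMatrix_mul_self`, `cycleLapEig`) and
`Matrix.MoorePenroseInverse` (Penrose 1955: `pinv`, `IsMoorePenroseInverse`,
`isMoorePenroseInverse_iff_eq_pinv`).  The header of `TensorNetworks.QTTLaplacePseudoinverse`
(PHW16 Theorems 2.2–2.3 in closed form) lists "PHW16 Theorem 2.4 (the Fourier diagonalisation
`A⁺ = F* diag(0, −1/(4 sin²(πk/N))) F`)" as not formalised; this file supplies that Fourier form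
(the result is the proof of COROLLARY 2.4 in the arXiv numbering), at the level of the circulant
`circ(2, −1, 0, …, 0, −1) = circulant (cycleLapVec ℂ N)`.

## The statements (verbatim)

[PHW16, proof of Corollary 2.4, arXiv p. 5]: "Since `A` in (2.1) [`A = circ(−2, 1, 0, …, 0, 1)ᵀ
∈ ℝ^{N×N}`] resp. `A²` are circulant matrices, they can be diagonalized by the Fourier matrix
`F_N = N^{−1/2} (ω_N^{jk})_{j,k=0}^{N−1}`, where `ω_N := e^{−2πi/N}`.  We obtain
`Â = F_N A F_N^* = diag(a(ω_N^k))_{k=0}^{N−1}` with the characteristic polynomial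
`a(z) := −2 + z + z^{N−1}` of `A`, i.e.,
`a(ω_N^k) = −2 + e^{−2πik/N} + e^{2πik/N} = −2 + 2cos(2πk/N) = −4 sin²(πk/N)`, `k = 0, …, N − 1`.
Observe that `a(ω_N^k)` are the eigenvalues of `A` resp. `Â`.  Considering the generalized
Moore–Penrose inverse, we obtain the circulant matrix `A⁺ = F_N^* Â⁺ F_N` with
`Â⁺ := diag(0, −1/(4 sin²(π/N)), −1/(4 sin²(2π/N)), …, −1/(4 sin²((N−1)π/N)))`.
Analogously, the Moore–Penrose inverse of `A²` can be written as `(A²)⁺ = F_N^* (Â⁺)² F_N`.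
A comparison of the entries `a⁺_j` (resp. `c⁺_j`) in the first column of `F_N^* Â⁺ F_N` (resp.
`F_N^* (Â⁺)² F_N`), `a⁺_j = (1/N) Σ_{k=1}^{N−1} (−1/(4 sin²(πk/N))) ω_N^{−jk} ω_N^{k0} = …`
[…] with the formulas found for `A⁺` (resp. `(A²)⁺`) in Theorems 2.2 and 2.3 yields the
assertions."

[Morillas2023, §4, before Theorem 13]: "The Fourier matrix of order `n` denoted with `F` is
given by `F(k,l) = n^{−1/2} e^{−2πi(k−1)(l−1)/n}`.  If `C = circ(c)`, then `C` is diagonalizable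
by `F`, `C = F̄ΛF`, `C† = F̄Λ†F`, `λ = √n F̄c` and `c = n^{−1/2} Fλ`, where `λ` is the diagonal
of `Λ`."

## What is formalised

CONVENTIONS.  We use the tree's unnormalised Fourier matrix `F = fourierMatrix N`,
`F_{jk} = ζ_k^j`, `ζ_k = cycleRoot N k = e^{2πik/N}`, with `Fᴴ F = N·1` (`CycleSpectrum`).
PHW's unitary `F_N` is `N^{−1/2} F̄ = N^{−1/2} Fᴴ` (`F` is symmetric), so PHW's `F_N^* D F_N` and
Morillas' `F̄ D F` (for diagonal `D`) both read `N⁻¹ · F D Fᴴ` here ("Fourier conjugation"), and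
the eigenvalue vector is GVL's `λ_k = circulantEig v k = Σ_m v_m ζ_k^{−m}`
(`circulant v = N⁻¹ · F diag(λ) Fᴴ`, `circulant_eq_fourier_conj`).  Lean's `0⁻¹ = 0` is exactly
the pseudo-inversion `λ ↦ λ⁺` of a diagonal entry, so `Λ† = diag(λ_k⁻¹)` and PHW's
`Â⁺ = diag(0, …)` need no case split (`sin 0 = 0`).  `circ(2, −1, 0, …, 0, −1) =
circulant (cycleLapVec ℂ N)` (`cycleLapVec = 2e₀ − e₁ − e₋₁`, `CirculantDFT`) is PHW's `−A`.

* §A (Fourier conjugation and the Penrose equations): for ANY diagonal `d`,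
  `N⁻¹ · F diag(d_k⁻¹) Fᴴ` satisfies the four Penrose equations for `N⁻¹ · F diag(d) Fᴴ`
  (`isMoorePenroseInverse_fourier_conj`), so `(N⁻¹ · F diag(d) Fᴴ)⁺ = N⁻¹ · F diag(d⁻¹) Fᴴ`
  (`pinv_fourier_conj`); the entries `(N⁻¹ · F diag(d) Fᴴ)_{ij} = N⁻¹ Σ_k d_k ζ_k^i ζ_k^{−j}`
  and first column `N⁻¹ Σ_k d_k ζ_k^j` (`fourier_conj_diagonal_apply(_zero)`; PHW's
  "`a⁺_j = (1/N) Σ_k â⁺_k ω_N^{−jk} ω_N^{k0}`").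
* §B ([Morillas2023, §4] "`C† = F̄Λ†F`"; [PHW16] "the circulant matrix `A⁺ = F_N^* Â⁺ F_N`"): for
  every complex circulant, `pinv (circulant v) = N⁻¹ · F diag(λ_k⁺) Fᴴ`
  (`isMoorePenroseInverse_circulant_fourier`, `pinv_circulant_eq_fourier_conj`), entrywise
  (`pinv_circulant_apply`), "`A⁺` is circulant": `= circ(d ↦ N⁻¹ Σ_k λ_k⁺ ζ_k^d)`
  (`pinv_circulant_eq_circulant`; Morillas' "`c = n^{−1/2} Fλ`" for `C†`), and for products
  `circ(v) circ(w) = N⁻¹ · F diag(λ(v)λ(w)) Fᴴ`, `(circ(v) circ(w))⁺ = N⁻¹ · F diag((λ(v)λ(w))⁺) Fᴴ`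
  (`circulant_mul_circulant_eq_fourier_conj`, `pinv_circulant_mul_circulant_eq_fourier_conj`;
  PHW's "`(A²)⁺ = F_N^* (Â⁺)² F_N`").
* §C (PHW16, proof of Cor. 2.4, for `circ(2, −1, 0, …, 0, −1) = −A`, all `N ≥ 1`):
  the symbol "`a(ω_N^k) = −4 sin²(πk/N)`": `λ_k(cycleLapVec) = 4 sin²(πk/N)`
  (`circulantEig_cycleLapVec_eq_sin_sq`, from `CirculantDFT`'s `2 − 2cos(2πk/N)`);
  "`Â = F_N A F_N^*`": `circ(2,−1,…,−1) = N⁻¹ · F diag(4 sin²(πk/N)) Fᴴ` and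
  `A = −circ(2,−1,…,−1) = N⁻¹ · F diag(−4 sin²(πk/N)) Fᴴ` (`circulant_cycleLapVec_eq_fourier_conj`,
  `neg_circulant_cycleLapVec_eq_fourier_conj`); "`A⁺ = F_N^* Â⁺ F_N`":
  `circ(2,−1,…,−1)⁺ = N⁻¹ · F diag((4 sin²(πk/N))⁻¹) Fᴴ` and, verbatim,
  `A⁺ = N⁻¹ · F diag((−4 sin²(πk/N))⁻¹) Fᴴ = F_N^* diag(0, −1/(4 sin²(πk/N)))_{k ≥ 1} F_N`
  (`pinv_circulant_cycleLapVec_eq_fourier_conj`, `pinv_neg_circulant_cycleLapVec_eq_fourier_conj`);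
  "`(A²)⁺ = F_N^* (Â⁺)² F_N`" (`pinv_circulant_cycleLapVec_mul_self_eq_fourier_conj`, `A² = (−A)²`);
  and the first columns `a⁺_j`, `c⁺_j` as DFT sums
  (`pinv_circulant_cycleLapVec_apply_zero`, `pinv_circulant_cycleLapVec_mul_self_apply_zero`).

Not formalised here: the final "comparison with Theorems 2.2 and 2.3", i.e. the trigonometric
identities that constitute the STATEMENT of Corollary 2.4 (they need the closed forms
`pinv_laplaceP`, `pinv_laplaceP_sq` of `TensorNetworks.QTTLaplacePseudoinverse` and the
identification `laplaceP = circulant (cycleLapVec)`); Morillas' Theorem 13 / Proposition 4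
(pseudoinverses of sums of circulants with disjoint spectral supports); PHW's Neumann matrix `B`
(not circulant).

AI-produced formalisation (H21 engines group, seat eng-quad-2, 2026-08-24); statements checked
against the arXiv texts; no facts, no axioms beyond Mathlib's, no `sorry`.
-/

open Matrix Finset
open scoped Real

namespace Literature.LinearAlgebra.Matrix

open MoorePenrose Literature.Combinatorics.SimpleGraph

variable {N : ℕ}

/-! ## A. Fourier conjugation `d ↦ N⁻¹ · F diag(d) Fᴴ` and the Penrose equations -/

section FourierConj

/-- Normalised Fourier conjugation `P ↦ N⁻¹ · F P Fᴴ` is multiplicative (`Fᴴ F = N · 1`).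
[folklore: `Fᴴ F = N · 1`, `conjTranspose_fourierMatrix_mul_self`] -/
private theorem fourier_conj_mul_fourier_conj [NeZero N] (P Q : Matrix (Fin N) (Fin N) ℂ) :
    (N : ℂ)⁻¹ • (fourierMatrix N * P * (fourierMatrix N)ᴴ) *
        ((N : ℂ)⁻¹ • (fourierMatrix N * Q * (fourierMatrix N)ᴴ)) =
      (N : ℂ)⁻¹ • (fourierMatrix N * (P * Q) * (fourierMatrix N)ᴴ) := by
  have hN : (N : ℂ) ≠ 0 := Nat.cast_ne_zero.mpr (NeZero.ne N)
  have h : fourierMatrix N * P * (fourierMatrix N)ᴴ * (fourierMatrix N * Q * (fourierMatrix N)ᴴ) =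
      (N : ℂ) • (fourierMatrix N * (P * Q) * (fourierMatrix N)ᴴ) := by
    calc fourierMatrix N * P * (fourierMatrix N)ᴴ * (fourierMatrix N * Q * (fourierMatrix N)ᴴ)
        = fourierMatrix N * P * ((fourierMatrix N)ᴴ * fourierMatrix N) * Q *
            (fourierMatrix N)ᴴ := by
          simp only [Matrix.mul_assoc]
      _ = (N : ℂ) • (fourierMatrix N * (P * Q) * (fourierMatrix N)ᴴ) := by
          rw [conjTranspose_fourierMatrix_mul_self, Matrix.mul_smul, Matrix.mul_one,
            Matrix.smul_mul, Matrix.smul_mul, Matrix.mul_assoc (fourierMatrix N) P Q]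
  rw [Matrix.smul_mul, Matrix.mul_smul, smul_smul, h, smul_smul, mul_assoc, inv_mul_cancel₀ hN,
    mul_one]

/-- For a REAL diagonal `e`, `N⁻¹ · F diag(e) Fᴴ` is Hermitian.  [folklore] -/
private theorem isHermitian_fourier_conj_ofReal (e : Fin N → ℝ) :
    ((N : ℂ)⁻¹ •
      (fourierMatrix N * diagonal (fun k => (e k : ℂ)) * (fourierMatrix N)ᴴ)).IsHermitian := by
  refine (isHermitian_mul_mul_conjTranspose _ (isHermitian_diagonal_of_self_adjoint _ ?_)).smul ?_
  · ext k
    simp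
  · exact (IsSelfAdjoint.natCast N).inv₀

/-- The entries of a Fourier conjugate: `(N⁻¹ · F diag(d) Fᴴ)_{ij} = N⁻¹ Σ_k d_k ζ_k^i ζ_k^{−j}`
(the inverse DFT of `d` at `i − j`; PHW's "`(1/N) Σ_k â_k ω_N^{−jk} ω_N^{kl}`" with
`ω_N = e^{−2πi/N} = ζ_1^{−1}`).  [cite: PlonkaHoffmannWeickert2016, Cor. 2.4 (proof)] -/
theorem fourier_conj_diagonal_apply (d : Fin N → ℂ) (i j : Fin N) :
    ((N : ℂ)⁻¹ • (fourierMatrix N * diagonal d * (fourierMatrix N)ᴴ)) i j =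
      (N : ℂ)⁻¹ * ∑ k, d k * (cycleRoot N k ^ (i : ℕ) * (cycleRoot N k ^ (j : ℕ))⁻¹) := by
  rw [Matrix.smul_apply, smul_eq_mul, Matrix.mul_apply]
  congr 1
  refine Finset.sum_congr rfl fun k _ => ?_
  rw [Matrix.mul_diagonal, conjTranspose_apply, fourierMatrix_apply, fourierMatrix_apply, star_pow,
    star_cycleRoot, inv_pow]
  ring

/-- … and of its first column: `(N⁻¹ · F diag(d) Fᴴ)_{j0} = N⁻¹ Σ_k d_k ζ_k^j` (PHW's
"`a⁺_j = (1/N) Σ_k â⁺_k ω_N^{−jk} ω_N^{k0}`").  [cite: PlonkaHoffmannWeickert2016, Cor. 2.4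
(proof)] -/
theorem fourier_conj_diagonal_apply_zero [NeZero N] (d : Fin N → ℂ) (j : Fin N) :
    ((N : ℂ)⁻¹ • (fourierMatrix N * diagonal d * (fourierMatrix N)ᴴ)) j 0 =
      (N : ℂ)⁻¹ * ∑ k, d k * cycleRoot N k ^ (j : ℕ) := by
  rw [fourier_conj_diagonal_apply]
  simp only [Fin.val_zero, pow_zero, inv_one, mul_one]

/-- `ζ_k^{(i − j) mod N} = ζ_k^i ζ_k^{−j}` (`ζ_k^N = 1`).  [folklore] -/
private theorem cycleRoot_pow_val_sub (k i j : Fin N) :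
    cycleRoot N k ^ ((i - j : Fin N) : ℕ) =
      cycleRoot N k ^ (i : ℕ) * (cycleRoot N k ^ (j : ℕ))⁻¹ := by
  have hζ := cycleRoot_ne_zero (N := N) k
  by_cases h : j ≤ i
  · rw [Fin.coe_sub_iff_le.mpr h, pow_sub₀ _ hζ (Fin.le_iff_val_le_val.mp h)]
  · rw [not_le] at h
    rw [Fin.coe_sub_iff_lt.mpr h, pow_sub₀ _ hζ (by omega), pow_add, cycleRoot_pow_card, one_mul]

/-- **The Penrose equations for a Fourier conjugate** ("`C = F̄ΛF`, `C† = F̄Λ†F`" [Morillas2023];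
"`Â⁺ := diag(0, −1/(4 sin²(π/N)), …)`, `A⁺ = F_N^* Â⁺ F_N`" [PHW16]): for any diagonal `d`, with
`d⁺_k = d_k⁻¹` (`d_k ≠ 0`), `= 0` (`d_k = 0`) — Lean's `d_k⁻¹` — the matrix `N⁻¹ · F diag(d⁺) Fᴴ`
satisfies `AXA = A`, `XAX = X`, `(AX)ᴴ = AX`, `(XA)ᴴ = XA` for `A = N⁻¹ · F diag(d) Fᴴ`
(`AX = XA = N⁻¹ · F diag(𝟙[d_k ≠ 0]) Fᴴ`).  [cite: Morillas2023, §4 (display before Thm. 13)]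
[cite: PlonkaHoffmannWeickert2016, Cor. 2.4 (proof)] -/
theorem isMoorePenroseInverse_fourier_conj [NeZero N] (d : Fin N → ℂ) :
    IsMoorePenroseInverse
      ((N : ℂ)⁻¹ • (fourierMatrix N * diagonal d * (fourierMatrix N)ᴴ))
      ((N : ℂ)⁻¹ • (fourierMatrix N * diagonal (fun k => (d k)⁻¹) * (fourierMatrix N)ᴴ)) := by
  -- the real `{0,1}`-valued diagonal `d d⁺ = d⁺ d`
  set e : Fin N → ℝ := fun k => if d k = 0 then 0 else 1 with he
  have hee : ∀ k, d k * (d k)⁻¹ = (e k : ℂ) := by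
    intro k
    rcases eq_or_ne (d k) 0 with h | h
    · simp [he, h]
    · simp [he, h]
  have d1 : diagonal d * diagonal (fun k => (d k)⁻¹) * diagonal d = diagonal d := by
    rw [diagonal_mul_diagonal, diagonal_mul_diagonal]
    congr 1
    funext k
    exact mul_inv_mul_cancel _
  have d2 : diagonal (fun k => (d k)⁻¹) * diagonal d * diagonal (fun k => (d k)⁻¹) =
      diagonal (fun k => (d k)⁻¹) := by
    rw [diagonal_mul_diagonal, diagonal_mul_diagonal]
    congr 1
    funext k
    rcases eq_or_ne (d k) 0 with h | h
    · simp [h]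
    · rw [inv_mul_cancel₀ h, one_mul]
  have d3 : diagonal d * diagonal (fun k => (d k)⁻¹) = diagonal (fun k => (e k : ℂ)) := by
    rw [diagonal_mul_diagonal]
    congr 1
    funext k
    exact hee k
  have d4 : diagonal (fun k => (d k)⁻¹) * diagonal d = diagonal (fun k => (e k : ℂ)) := by
    rw [diagonal_mul_diagonal]
    congr 1
    funext k
    rw [mul_comm]
    exact hee k
  refine ⟨?_, ?_, ?_, ?_⟩
  · rw [fourier_conj_mul_fourier_conj, fourier_conj_mul_fourier_conj, d1]
  · rw [fourier_conj_mul_fourier_conj, fourier_conj_mul_fourier_conj, d2]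
  · rw [fourier_conj_mul_fourier_conj, d3]
    exact isHermitian_fourier_conj_ofReal e
  · rw [fourier_conj_mul_fourier_conj, d4]
    exact isHermitian_fourier_conj_ofReal e

/-- `(N⁻¹ · F diag(d) Fᴴ)⁺ = N⁻¹ · F diag(d⁺) Fᴴ` ("`C† = F̄Λ†F`").
[cite: Morillas2023, §4 (display before Thm. 13)] [cite: PlonkaHoffmannWeickert2016, Cor. 2.4
(proof)] -/
theorem pinv_fourier_conj [NeZero N] (d : Fin N → ℂ) :
    pinv ((N : ℂ)⁻¹ • (fourierMatrix N * diagonal d * (fourierMatrix N)ᴴ)) =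
      (N : ℂ)⁻¹ • (fourierMatrix N * diagonal (fun k => (d k)⁻¹) * (fourierMatrix N)ᴴ) :=
  (isMoorePenroseInverse_iff_eq_pinv.mp (isMoorePenroseInverse_fourier_conj d)).symm

end FourierConj

/-! ## B. The Moore–Penrose inverse of a circulant matrix [Morillas2023, §4] -/

section CirculantPinv

/-- **The Moore–Penrose inverse of a circulant, via the DFT**: with `λ_k = circulantEig v k`
the eigenvalues of `circ(v)` (GVL Thm. 4.8.2), `N⁻¹ · F diag(λ⁺) Fᴴ` satisfies the four Penrose
equations for `circ(v)`.  [cite: Morillas2023, §4 (display before Thm. 13)]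
[cite: PlonkaHoffmannWeickert2016, Cor. 2.4 (proof)] [cite: GolubVanLoan2013, §4.8.2 Thm 4.8.2] -/
theorem isMoorePenroseInverse_circulant_fourier [NeZero N] (v : Fin N → ℂ) :
    IsMoorePenroseInverse (circulant v)
      ((N : ℂ)⁻¹ • (fourierMatrix N * diagonal (fun k => (circulantEig v k)⁻¹) *
        (fourierMatrix N)ᴴ)) := by
  rw [circulant_eq_fourier_conj v]
  exact isMoorePenroseInverse_fourier_conj _

/-- "`C† = F̄Λ†F`" [Morillas2023, §4] / "`A⁺ = F_N^* Â⁺ F_N`" [PHW16]: the Moore–Penrose inverse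
of a complex circulant is `N⁻¹ · F diag(λ_k⁺) Fᴴ`.
[cite: Morillas2023, §4 (display before Thm. 13)] [cite: PlonkaHoffmannWeickert2016, Cor. 2.4
(proof)] -/
theorem pinv_circulant_eq_fourier_conj [NeZero N] (v : Fin N → ℂ) :
    pinv (circulant v) =
      (N : ℂ)⁻¹ • (fourierMatrix N * diagonal (fun k => (circulantEig v k)⁻¹) *
        (fourierMatrix N)ᴴ) :=
  (isMoorePenroseInverse_iff_eq_pinv.mp (isMoorePenroseInverse_circulant_fourier v)).symm

/-- Entrywise: `(circ v)⁺_{ij} = N⁻¹ Σ_k λ_k⁺ ζ_k^{i} ζ_k^{−j}`.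
[cite: PlonkaHoffmannWeickert2016, Cor. 2.4 (proof)] [cite: Morillas2023, §4 (display before
Thm. 13)] -/
theorem pinv_circulant_apply [NeZero N] (v : Fin N → ℂ) (i j : Fin N) :
    pinv (circulant v) i j =
      (N : ℂ)⁻¹ *
        ∑ k, (circulantEig v k)⁻¹ * (cycleRoot N k ^ (i : ℕ) * (cycleRoot N k ^ (j : ℕ))⁻¹) := by
  rw [pinv_circulant_eq_fourier_conj, fourier_conj_diagonal_apply]

/-- "We obtain the circulant matrix `A⁺ = F_N^* Â⁺ F_N`" [PHW16] / "`c = n^{−1/2} Fλ`"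
[Morillas2023]: the Moore–Penrose inverse of a circulant is the circulant whose first column is the
inverse DFT `d ↦ N⁻¹ Σ_k λ_k⁺ ζ_k^d` of the pseudo-inverted eigenvalues.
[cite: PlonkaHoffmannWeickert2016, Cor. 2.4 (proof)] [cite: Morillas2023, §4 (display before
Thm. 13)] -/
theorem pinv_circulant_eq_circulant [NeZero N] (v : Fin N → ℂ) :
    pinv (circulant v) =
      circulant (fun d : Fin N =>
        (N : ℂ)⁻¹ * ∑ k, (circulantEig v k)⁻¹ * cycleRoot N k ^ (d : ℕ)) := by
  ext i j
  rw [pinv_circulant_apply, circulant_apply]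
  congr 1
  refine Finset.sum_congr rfl fun k _ => ?_
  rw [cycleRoot_pow_val_sub]

/-- Products of circulants are Fourier conjugates of the products of the eigenvalues:
`circ(v) circ(w) = N⁻¹ · F diag(λ_k(v) λ_k(w)) Fᴴ` (so `A² = F_N^* Â² F_N`).
[cite: GolubVanLoan2013, §4.8.2 Thm 4.8.2] [cite: PlonkaHoffmannWeickert2016, Cor. 2.4 (proof)] -/
theorem circulant_mul_circulant_eq_fourier_conj [NeZero N] (v w : Fin N → ℂ) :
    circulant v * circulant w =
      (N : ℂ)⁻¹ • (fourierMatrix N * diagonal (fun k => circulantEig v k * circulantEig w k) *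
        (fourierMatrix N)ᴴ) := by
  rw [circulant_eq_fourier_conj v, circulant_eq_fourier_conj w, fourier_conj_mul_fourier_conj,
    diagonal_mul_diagonal]

/-- "Analogously, the Moore–Penrose inverse of `A²` can be written as `(A²)⁺ = F_N^* (Â⁺)² F_N`":
`(circ(v) circ(w))⁺ = N⁻¹ · F diag((λ_k(v) λ_k(w))⁺) Fᴴ`.
[cite: PlonkaHoffmannWeickert2016, Cor. 2.4 (proof)] [cite: Morillas2023, §4 (display before
Thm. 13)] -/
theorem pinv_circulant_mul_circulant_eq_fourier_conj [NeZero N] (v w : Fin N → ℂ) :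
    pinv (circulant v * circulant w) =
      (N : ℂ)⁻¹ • (fourierMatrix N *
        diagonal (fun k => (circulantEig v k * circulantEig w k)⁻¹) * (fourierMatrix N)ᴴ) := by
  rw [circulant_mul_circulant_eq_fourier_conj]
  exact pinv_fourier_conj _

end CirculantPinv

/-! ## C. [PHW16], proof of Corollary 2.4: `A = circ(−2, 1, 0, …, 0, 1)`, `Â`, `A⁺`, `(A²)⁺` -/

section PeriodicLaplacian

/-- `2 − 2cos(2x) = 4 sin² x`.  [folklore: double-angle formula] -/
private theorem two_sub_two_cos_two_mul (x : ℝ) :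
    2 - 2 * Real.cos (2 * x) = 4 * Real.sin x ^ 2 := by
  rw [Real.sin_sq_eq_half_sub]
  ring

/-- "`a(ω_N^k) = −2 + e^{−2πik/N} + e^{2πik/N} = −2 + 2cos(2πk/N) = −4 sin²(πk/N)`,
`k = 0, …, N − 1`" — for `−A = circ(2, −1, 0, …, 0, −1)`: the eigenvalue of
`circulant (cycleLapVec ℂ N)` on the `k`-th Fourier mode is `4 sin²(πk/N)`
(`CirculantDFT`: `2 − 2cos(2πk/N)`).  [cite: PlonkaHoffmannWeickert2016, Cor. 2.4 (proof)] -/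
theorem circulantEig_cycleLapVec_eq_sin_sq [NeZero N] (k : Fin N) :
    circulantEig (cycleLapVec ℂ N) k = ((4 * Real.sin (π * (k : ℕ) / N) ^ 2 : ℝ) : ℂ) := by
  obtain ⟨n, rfl⟩ := Nat.exists_eq_add_one_of_ne_zero (NeZero.ne N)
  rw [circulantEig_cycleLapVec, cycleLapEig, cycleAngle]
  congr 1
  have hx : (2 * π * (k : ℕ) / (n + 1 : ℕ) : ℝ) = 2 * (π * (k : ℕ) / (n + 1 : ℕ)) := by ring
  rw [hx, two_sub_two_cos_two_mul]

/-- "`Â = F_N A F_N^* = diag(a(ω_N^k))`" — for `−A = circ(2, −1, 0, …, 0, −1)` in the tree's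
normalisation: `circ(2, −1, 0, …, 0, −1) = N⁻¹ · F diag(4 sin²(πk/N)) Fᴴ`.
[cite: PlonkaHoffmannWeickert2016, Cor. 2.4 (proof)] [cite: GolubVanLoan2013, §4.8.2 Thm 4.8.2] -/
theorem circulant_cycleLapVec_eq_fourier_conj (N : ℕ) [NeZero N] :
    circulant (cycleLapVec ℂ N) =
      (N : ℂ)⁻¹ • (fourierMatrix N *
        diagonal (fun k : Fin N => ((4 * Real.sin (π * (k : ℕ) / N) ^ 2 : ℝ) : ℂ)) *
          (fourierMatrix N)ᴴ) := by
  have h : circulantEig (cycleLapVec ℂ N) =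
      fun k : Fin N => ((4 * Real.sin (π * (k : ℕ) / N) ^ 2 : ℝ) : ℂ) :=
    funext circulantEig_cycleLapVec_eq_sin_sq
  rw [circulant_eq_fourier_conj, h]

/-- PHW's matrix itself: `A = circ(−2, 1, 0, …, 0, 1) = F_N^* diag(−4 sin²(πk/N)) F_N`, i.e.
`−circ(2, −1, 0, …, 0, −1) = N⁻¹ · F diag(−4 sin²(πk/N)) Fᴴ`.
[cite: PlonkaHoffmannWeickert2016, Cor. 2.4 (proof)] -/
theorem neg_circulant_cycleLapVec_eq_fourier_conj (N : ℕ) [NeZero N] :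
    -circulant (cycleLapVec ℂ N) =
      (N : ℂ)⁻¹ • (fourierMatrix N *
        diagonal (fun k : Fin N => ((-(4 * Real.sin (π * (k : ℕ) / N) ^ 2) : ℝ) : ℂ)) *
          (fourierMatrix N)ᴴ) := by
  rw [circulant_cycleLapVec_eq_fourier_conj, ← smul_neg, ← Matrix.neg_mul, ← Matrix.mul_neg,
    diagonal_neg]
  simp only [Complex.ofReal_neg]

/-- **"`A⁺ = F_N^* Â⁺ F_N`"** for the stiffness matrix `−A = circ(2, −1, 0, …, 0, −1)`:
`circ(2, −1, 0, …, 0, −1)⁺ = N⁻¹ · F diag((4 sin²(πk/N))⁺) Fᴴ` (the `k = 0` entry is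
`(4 sin² 0)⁻¹ = 0⁻¹ = 0`).  [cite: PlonkaHoffmannWeickert2016, Cor. 2.4 (proof)] -/
theorem pinv_circulant_cycleLapVec_eq_fourier_conj (N : ℕ) [NeZero N] :
    pinv (circulant (cycleLapVec ℂ N)) =
      (N : ℂ)⁻¹ • (fourierMatrix N *
        diagonal (fun k : Fin N => (((4 * Real.sin (π * (k : ℕ) / N) ^ 2)⁻¹ : ℝ) : ℂ)) *
          (fourierMatrix N)ᴴ) := by
  rw [circulant_cycleLapVec_eq_fourier_conj, pinv_fourier_conj]
  simp only [Complex.ofReal_inv]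

/-- The printed statement: "we obtain the circulant matrix `A⁺ = F_N^* Â⁺ F_N` with
`Â⁺ := diag(0, −1/(4 sin²(π/N)), −1/(4 sin²(2π/N)), …, −1/(4 sin²((N−1)π/N)))`" for
`A = circ(−2, 1, 0, …, 0, 1) = −circ(2, −1, 0, …, 0, −1)` (in the tree's normalisation
`F_N^* D F_N = N⁻¹ · F D Fᴴ`; the `k = 0` entry is `(−4 sin² 0)⁻¹ = 0`).
[cite: PlonkaHoffmannWeickert2016, Cor. 2.4 (proof)] -/
theorem pinv_neg_circulant_cycleLapVec_eq_fourier_conj (N : ℕ) [NeZero N] :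
    pinv (-circulant (cycleLapVec ℂ N)) =
      (N : ℂ)⁻¹ • (fourierMatrix N *
        diagonal (fun k : Fin N => (((-(4 * Real.sin (π * (k : ℕ) / N) ^ 2))⁻¹ : ℝ) : ℂ)) *
          (fourierMatrix N)ᴴ) := by
  rw [neg_circulant_cycleLapVec_eq_fourier_conj, pinv_fourier_conj]
  simp only [Complex.ofReal_inv]

/-- "Analogously, the Moore–Penrose inverse of `A²` can be written as
`(A²)⁺ = F_N^* (Â⁺)² F_N`": `(circ(2,−1,…,−1)²)⁺ = N⁻¹ · F diag(((4 sin²(πk/N))⁺)²) Fᴴ`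
(`A² = (−A)²`).  [cite: PlonkaHoffmannWeickert2016, Cor. 2.4 (proof)] -/
theorem pinv_circulant_cycleLapVec_mul_self_eq_fourier_conj (N : ℕ) [NeZero N] :
    pinv (circulant (cycleLapVec ℂ N) * circulant (cycleLapVec ℂ N)) =
      (N : ℂ)⁻¹ • (fourierMatrix N *
        diagonal (fun k : Fin N => (((4 * Real.sin (π * (k : ℕ) / N) ^ 2)⁻¹ ^ 2 : ℝ) : ℂ)) *
          (fourierMatrix N)ᴴ) := by
  have h : (fun k : Fin N => (((4 * Real.sin (π * (k : ℕ) / N) ^ 2 : ℝ) : ℂ) *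
      ((4 * Real.sin (π * (k : ℕ) / N) ^ 2 : ℝ) : ℂ))⁻¹) =
      fun k : Fin N => (((4 * Real.sin (π * (k : ℕ) / N) ^ 2)⁻¹ ^ 2 : ℝ) : ℂ) := by
    funext k
    push_cast
    ring
  rw [circulant_cycleLapVec_eq_fourier_conj, fourier_conj_mul_fourier_conj, diagonal_mul_diagonal,
    pinv_fourier_conj, h]

/-- PHW's `A²` verbatim: `((−circ(2,−1,…,−1))²)⁺ = N⁻¹ · F diag((Â⁺)²) Fᴴ`.
[cite: PlonkaHoffmannWeickert2016, Cor. 2.4 (proof)] -/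
theorem pinv_neg_circulant_cycleLapVec_mul_self_eq_fourier_conj (N : ℕ) [NeZero N] :
    pinv (-circulant (cycleLapVec ℂ N) * -circulant (cycleLapVec ℂ N)) =
      (N : ℂ)⁻¹ • (fourierMatrix N *
        diagonal (fun k : Fin N => (((-(4 * Real.sin (π * (k : ℕ) / N) ^ 2))⁻¹ ^ 2 : ℝ) : ℂ)) *
          (fourierMatrix N)ᴴ) := by
  rw [neg_mul_neg, pinv_circulant_cycleLapVec_mul_self_eq_fourier_conj]
  simp only [inv_neg, neg_sq]

/-- The first column of `A⁺ = F_N^* Â⁺ F_N` as a DFT sum — "`a⁺_j = (1/N) Σ_{k=1}^{N−1}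
(−1/(4 sin²(πk/N))) ω_N^{−jk} ω_N^{k0}`" — for `−A`:
`circ(2,−1,…,−1)⁺_{j0} = N⁻¹ Σ_{k : Fin N} (4 sin²(πk/N))⁺ ζ_k^j` (the `k = 0` term vanishes).
[cite: PlonkaHoffmannWeickert2016, Cor. 2.4 (proof)] -/
theorem pinv_circulant_cycleLapVec_apply_zero [NeZero N] (j : Fin N) :
    pinv (circulant (cycleLapVec ℂ N)) j 0 =
      (N : ℂ)⁻¹ * ∑ k : Fin N, (((4 * Real.sin (π * (k : ℕ) / N) ^ 2)⁻¹ : ℝ) : ℂ) *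
        cycleRoot N k ^ (j : ℕ) := by
  rw [pinv_circulant_cycleLapVec_eq_fourier_conj, fourier_conj_diagonal_apply_zero]

/-- The first column of `(A²)⁺ = F_N^* (Â⁺)² F_N` as a DFT sum ("`c⁺_j = (1/N) Σ_{k=1}^{N−1}
−(cos(2πkj/N) + i sin(2πkj/N)) / (16 sin⁴(kπ/N))`" up to PHW's sign conventions):
`(circ(2,−1,…,−1)²)⁺_{j0} = N⁻¹ Σ_{k : Fin N} ((4 sin²(πk/N))⁺)² ζ_k^j`.
[cite: PlonkaHoffmannWeickert2016, Cor. 2.4 (proof)] -/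
theorem pinv_circulant_cycleLapVec_mul_self_apply_zero [NeZero N] (j : Fin N) :
    pinv (circulant (cycleLapVec ℂ N) * circulant (cycleLapVec ℂ N)) j 0 =
      (N : ℂ)⁻¹ * ∑ k : Fin N, (((4 * Real.sin (π * (k : ℕ) / N) ^ 2)⁻¹ ^ 2 : ℝ) : ℂ) *
        cycleRoot N k ^ (j : ℕ) := by
  rw [pinv_circulant_cycleLapVec_mul_self_eq_fourier_conj, fourier_conj_diagonal_apply_zero]

end PeriodicLaplacian

end Literature.LinearAlgebra.Matrix
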